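/-
Origin: expansion seat `prover-pub-hodgecm-mc-carch-1-g35-0`, handover #CA60 2026-08-20T22:21Z md5 df45f5e2f13e (769 l.; r2 = r1 6785183d8007 + § 4b; NEW additive leaf; imports Model.ArchLineDatumOf + Vendored…Automorphic.UnitaryGroupAdelicLineTorus; ns HodgeCM.Model.ArchSideTerm; NAMES for audit: HodgeCM.Model.ArchSideTerm.lineRepOf_zero_one_inf_eq_adelicTensorEnd · HodgeCM.Model.ArchSideTerm.lineRepOf_zero_one_inf_blockFamily_tmul · HodgeCM.Model.ArchSideTerm.lineRepD_zero_one_inf_blockFamily_tmul · HodgeCM.Model.ArchSideTerm.cmArchWeilRep_center_blockFamilyOfAt · HodgeCM.Model.ArchSideTerm.cmCenter_finLineTorus · HodgeCM.Model.ArchSideTerm.lineRepOf_zero_one_finLineTorus · HodgeCM.Model.ArchSideTerm.finLineTorus_injective · HodgeCM.Model.ArchSideTerm.archPart_cmCenter_symm · HodgeCM.Model.ArchSideTerm.eq_relNormOneInfToIdeles_mul_finLineTorusIdeles) (`HOME/mc/pub-hodgecm-mc-carch-1/stage65/HodgeCM/Model/ArchKTypeOfTorus.lean`, md5 df45f5e2f13e,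 769 lines);
landed by the gen-27 packager (p-g27) in gate run 65 as `HodgeCM/Model/ArchKTypeOfTorus.lean` (verbatim).
-/
/-
Copyright (c) 2026. Released under Apache 2.0 license as described in the file LICENSE.
Cell pub-hodgecm, MODEL layer (construction prover mc-carch-1, gen 35), row-9 (J-Liu-Θ) junction, (J4) distribution input:
the TORUS slot `(1, t)` of the honest S-side line representations `lineRepOf … k`, archimedean and finite, BY NAME
(theta-3-g26 WEIL-CUSTODY ANSWER 2026-08-20 «(iii)_∞ `(1, u_∞)` … carch's twin to write»; sinst-1-g9 «the two honest hypotheses left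
for the distribution file — (iii)_∞ and the torus bookkeeping `adelicCenter ↔ finAdelicToAdelic (M := 1)`»).
-/
import Summits.HodgeConjecture.HodgeCM.Model.ArchLineDatumOf_3
import Literature.NumberTheory.Automorphic.UnitaryGroupAdelicLineTorus

/-!
# The torus slot of the honest line representations: `(1, t_∞)` is pure-tensor, `(1, t_f)` is the line's finite unitary group

`lineRepOf V S hGR hGR₀ hGR₁ hGR₂ hGR₃ η₀ η₁ η₂ η₃ k` (LAYER B `Model/ArchSideTerm`) is a representation of
`↥(regimeSubgroup L V.Hm) × ker N_{L/L⁺}(𝔸)`; its second slot is the torus `U(W_k)(𝔸) = U(1)(𝔸_{L⁺})` of the line `W_k = ⟨a_k⟩`.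
theta-3's collapse at `g = 1` (`lineRepOf_k_one_center`, `Model/ArchLineInputOf`: `lineRepOf k (1, t) = c_k(u) • ω_k(u · 1_V, 1)`,
`u = t♭`, the CENTRE SWAP) reduces the torus to the centre of `U(V)(𝔸)`; this file reads that back in the two currencies the
(J4) theta distribution `Φ_f ↦ θ(Φ_∞ ⊗ Φ_f, χ)` (sinst-1 `Model/AdelicThetaDistribution`) consumes:

* § 1 `torusScalar_kG … η_k : U(1)(𝔸_{L⁺}) →* ℂˣ` — the scalar `u ↦ η_k(1, u) · χ_k(1, u · 1_{W_k})` of the collapse, as a CHARACTER;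
* § 2 **(iii)_∞, operator form** `lineRepOf_k_one_inf_eq_adelicTensorEnd`: at an ARCHIMEDEAN torus element `t_∞ ∈ U(1)(L⁺ ⊗ ℝ)`
  (`relNormOneInfToIdeles t_∞ = (t_∞, 1)`), `lineRepOf k (1, (t_∞, 1)) = (c_k((t_∞,1)♭) • ω_∞,k(t_∞ · 1_V, 1)) ⊗ 1` as OPERATORS on
  `𝒮(𝔸_{L⁺}^3)` — theta-3-g11's `cmPairRep_cmCenter_inf_one_eq` (tree p194977 `archToAdelic_cmArchCenter` + carch #CA2
  `cmPairRep_archToAdelic_eq_adelicTensorEnd`) behind the collapse; hence on EVERY pure tensor (§ 2, `…_apply_tmul`):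
  `lineRepOf k (1, (t_∞,1)) (Φ_∞ ⊗ Φ_f) = (c_k • ω_∞,k(t_∞ · 1_V, 1) Φ_∞) ⊗ Φ_f` for ALL `Φ_f` (the `WeilPairData.weight` field only
  speaks about `Φ_f = 1_{x₀ + N𝒪̂}`);
* § 3 **the archimedean torus weight of the honest harmonic FAMILY, for every `Φ_f`**: the centre `t_∞ · 1_V` acts on every member
  `blockFamilyOfAt … (degOnePDual S') (binvPi 1) ℓ` of carch's slot family of the line `⟨d⟩` (#CA13; theta-3's `linePhi` is `ℓ = ⟨e₀, ·⟩`,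
  `S' = Empty`) by theta-3's eigenvalue `lineC V d … t_∞ = χ(t_∞) · ι_{w(v₁)}(t_∞)` (`cmArchWeilRep_center_blockFamilyOfAt`, from
  `blockFamilyOfAt_degOnePDual_binvPi_one` + `cmArchWeilRep_center_follandFock_linePlacePoly`), so
  `lineRepOf k (1, (t_∞,1)) (Φ_∞,k(ℓ) ⊗ Φ_f) = (c_k · lineC_k)(t_∞) • (Φ_∞,k(ℓ) ⊗ Φ_f)` and, under the (J-μ)_k identity of
  `ArchLineDatum` (the hypothesis `hμ_k` of `archLineDatumOf`, unchanged), `lineRepD k (1, (t_∞,1)) (Φ_∞,k(ℓ) ⊗ Φ_f) =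
  archWeight L (μ k) t_∞ • (Φ_∞,k(ℓ) ⊗ Φ_f)` — (W-wt) for the whole family and every finite test function;
* § 4 **torus bookkeeping at the finite places**: `finLineTorus L d : U(⟨d⟩)(𝔸_{L⁺,f}) →* U(1)(𝔸_{L⁺})`, `u_f ↦ det (1, u_f)` (tree
  `cmAdelicDet ∘ finAdelicToAdelic`), with `CMCenter L (lineVec L d) (finLineTorus L d u_f) = finAdelicToAdelic u_f`
  (`cmCenter_finLineTorus`: a `1 × 1` unitary matrix is its determinant times `1₁`) — so
  `lineRepOf k (1, ♯(finLineTorus (a_k) u_f)) = c_k(finLineTorus u_f) • cmPairRep e₁ hGR_k (1, (1, u_f))`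
  (`lineRepOf_k_one_finLineTorus`), the input shape of theta-3's `omega_pairSmall₁_finPairToAdelic_tmul` /
  `pairRep_finPairToAdelic_piSBReindex_tmul` at the pair element `finPairToAdelic (1, u_f)` ((iii)_fin); and (§ 4b) EVERY torus element
  factors through these two cases: `archPart_cmCenter_symm` (`(t♭ · 1_N)_∞ = t_∞ · 1_N`, any rank), `finLineTorusInv K d : ker N →* U(⟨d⟩)(𝔸_f)`
  (`t ↦ (t♭ · 1₁)_f`, left inverse of `finLineTorusIdeles`), `cmCenter_symm_eq_archToAdelic_mul_finAdelicToAdelic` and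
  **`eq_relNormOneInfToIdeles_mul_finLineTorusIdeles : t = (t_∞, 1) · ♯ det (1_∞, t_f)`** — so `lineRepOf k (1, t)` for ANY `t` is
  `lineRepOf k (1, (t_∞,1)) ∘ lineRepOf k (1, ♯ det (1_∞, t_f))` (`map_mul`), § 2 ∘ § 4.

Nothing is cited and nothing is minted: kernel lemmas and `MonoidHom` compositions over installed modules
(`Model/ArchLineDatumOf` ⊇ `Model/ArchLineInputOf`, `Model/ArchKTypeOfArch`, `Model/ArchKTypeOfSlot`, the vendored tree);
0 records, 0 `def … : Prop`.
-/

set_option autoImplicit false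

noncomputable section

open NumberField NumberField.InfinitePlace NumberField.mixedEmbedding IsDedekindDomain
open scoped Matrix TensorProduct Classical SchwartzMap
open Literature.NumberTheory.Automorphic Literature.NumberTheory.Automorphic.UnitaryGroup Literature.NumberTheory.Weil1964
open Literature.RepresentationTheory.KonnoKonno2007 Literature.RepresentationTheory.KonnoKonno2007.RealDualPair
open Literature.NumberTheory.GelbartRogawski1991 Literature.NumberTheory.GelbartRogawski1991.UnitaryDualPair
open Literature.Analysis.SegalBargmann
open HodgeCM.Adelic HodgeCM.PerL34 HodgeCM.Model.HypCensus HodgeCM.Model.SupplyInstance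

namespace HodgeCM.Model.ArchSideTerm

variable {L : CMField} {ι₁ : L →+* ℂ} (V : HermSpace3 L ι₁) (S : StubTree.SeesawDatum L)

section Torus

variable
  (hGR : (cmSplittingDatum (L : Type) finProdFinEquiv (frameD V) (frameD_real V) (frameD_ne V) (dW S) (dW_real S) (dW_ne S)).CompatibleSplitting)
  (hGR₀ : (cmSplittingDatum (L : Type) (e₁) (frameD V) (frameD_real V) (frameD_ne V) (lineVec (L : Type) (dW S 0))
    (fun _ => dW_real S 0) (fun _ => dW_ne S 0)).CompatibleSplitting)
  (hGR₁ : (cmSplittingDatum (L : Type) (e₁) (frameD V) (frameD_real V) (frameD_ne V) (lineVec (L : Type) (dW S 1))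
    (fun _ => dW_real S 1) (fun _ => dW_ne S 1)).CompatibleSplitting)
  (hGR₂ : (cmSplittingDatum (L : Type) (e₁) (frameD V) (frameD_real V) (frameD_ne V) (lineVec (L : Type) (dW' S 0))
    (fun _ => dW'_real S 0) (fun _ => dW'_ne S 0)).CompatibleSplitting)
  (hGR₃ : (cmSplittingDatum (L : Type) (e₁) (frameD V) (frameD_real V) (frameD_ne V) (lineVec (L : Type) (dW' S 1))
    (fun _ => dW'_real S 1) (fun _ => dW'_ne S 1)).CompatibleSplitting)
  (η₀ η₁ η₂ η₃ : CMAdelic (L : Type) (frameD V) × CMAdelicOne (L : Type) →* ℂˣ)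

/-! ### § 1. The torus scalars of the four lines as characters of `U(1)(𝔸_{L⁺})` -/

/-- **the torus scalar of line 0**: `u ↦ η₀(1, u) · χ₀(1, u · 1_{⟨a₀⟩})` (the scalar of `lineRepOf_zero_one_center`). -/
def torusScalar_zeroG : CMAdelicOne (L : Type) →* ℂˣ :=
  η₀.comp ((1 : CMAdelicOne (L : Type) →* CMAdelic (L : Type) (frameD V)).prod (MonoidHom.id _)) *
    (cmLineChar₀ (L : Type) finProdFinEquiv e₁ (frameD V) (frameD_real V) (frameD_ne V) (dW S) (dW_real S) (dW_ne S) hGR hGR₀ hGR₁).comp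
      ((1 : CMAdelicOne (L : Type) →* CMAdelic (L : Type) (frameD V)).prod (CMCenter (L : Type) (lineVec (L : Type) (dW S 0))))

/-- (Ported verbatim from the HodgeCMPerL package; no docstring in the source.) -/
theorem torusScalar_zero_applyG (u : CMAdelicOne (L : Type)) :
    torusScalar_zeroG V S hGR hGR₀ hGR₁ η₀ u =
      η₀ (1, u) * cmLineChar₀ (L : Type) finProdFinEquiv e₁ (frameD V) (frameD_real V) (frameD_ne V) (dW S) (dW_real S) (dW_ne S) hGR hGR₀ hGR₁
        (1, CMCenter (L : Type) (lineVec (L : Type) (dW S 0)) u) :=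
  rfl

/-- **the torus scalar of line 1**: `u ↦ η₁(1, u) · χ₁(1, u · 1_{⟨a₁⟩})`. -/
def torusScalar_oneG : CMAdelicOne (L : Type) →* ℂˣ :=
  η₁.comp ((1 : CMAdelicOne (L : Type) →* CMAdelic (L : Type) (frameD V)).prod (MonoidHom.id _)) *
    (cmLineChar₁ (L : Type) finProdFinEquiv e₁ (frameD V) (frameD_real V) (frameD_ne V) (dW S) (dW_real S) (dW_ne S) hGR hGR₀ hGR₁).comp
      ((1 : CMAdelicOne (L : Type) →* CMAdelic (L : Type) (frameD V)).prod (CMCenter (L : Type) (lineVec (L : Type) (dW S 1))))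

/-- (Ported verbatim from the HodgeCMPerL package; no docstring in the source.) -/
theorem torusScalar_one_applyG (u : CMAdelicOne (L : Type)) :
    torusScalar_oneG V S hGR hGR₀ hGR₁ η₁ u =
      η₁ (1, u) * cmLineChar₁ (L : Type) finProdFinEquiv e₁ (frameD V) (frameD_real V) (frameD_ne V) (dW S) (dW_real S) (dW_ne S) hGR hGR₀ hGR₁
        (1, CMCenter (L : Type) (lineVec (L : Type) (dW S 1)) u) :=
  rfl

/-- **the torus scalar of line 2** (conjugated plane): `u ↦ η₂(1, u) · χ₂(1, u · 1_{⟨a₂⟩})`. -/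
def torusScalar_twoG : CMAdelicOne (L : Type) →* ℂˣ :=
  η₂.comp ((1 : CMAdelicOne (L : Type) →* CMAdelic (L : Type) (frameD V)).prod (MonoidHom.id _)) *
    (cmConjLineChar₀ (L : Type) finProdFinEquiv e₁ (frameD V) (frameD_real V) (frameD_ne V) (dW S) (dW_real S) (dW_ne S)
        (dW' S) (dW'_real S) (dW'_ne S) S.isoGL (isoGL_hg₀ S) hGR hGR₂ hGR₃).comp
      ((1 : CMAdelicOne (L : Type) →* CMAdelic (L : Type) (frameD V)).prod (CMCenter (L : Type) (lineVec (L : Type) (dW' S 0))))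

/-- (Ported verbatim from the HodgeCMPerL package; no docstring in the source.) -/
theorem torusScalar_two_applyG (u : CMAdelicOne (L : Type)) :
    torusScalar_twoG V S hGR hGR₂ hGR₃ η₂ u =
      η₂ (1, u) * cmConjLineChar₀ (L : Type) finProdFinEquiv e₁ (frameD V) (frameD_real V) (frameD_ne V) (dW S) (dW_real S) (dW_ne S)
        (dW' S) (dW'_real S) (dW'_ne S) S.isoGL (isoGL_hg₀ S) hGR hGR₂ hGR₃ (1, CMCenter (L : Type) (lineVec (L : Type) (dW' S 0)) u) :=
  rfl

/-- **the torus scalar of line 3** (conjugated plane): `u ↦ η₃(1, u) · χ₃(1, u · 1_{⟨a₃⟩})`. -/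
def torusScalar_threeG : CMAdelicOne (L : Type) →* ℂˣ :=
  η₃.comp ((1 : CMAdelicOne (L : Type) →* CMAdelic (L : Type) (frameD V)).prod (MonoidHom.id _)) *
    (cmConjLineChar₁ (L : Type) finProdFinEquiv e₁ (frameD V) (frameD_real V) (frameD_ne V) (dW S) (dW_real S) (dW_ne S)
        (dW' S) (dW'_real S) (dW'_ne S) S.isoGL (isoGL_hg₀ S) hGR hGR₂ hGR₃).comp
      ((1 : CMAdelicOne (L : Type) →* CMAdelic (L : Type) (frameD V)).prod (CMCenter (L : Type) (lineVec (L : Type) (dW' S 1))))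

/-- (Ported verbatim from the HodgeCMPerL package; no docstring in the source.) -/
theorem torusScalar_three_applyG (u : CMAdelicOne (L : Type)) :
    torusScalar_threeG V S hGR hGR₂ hGR₃ η₃ u =
      η₃ (1, u) * cmConjLineChar₁ (L : Type) finProdFinEquiv e₁ (frameD V) (frameD_real V) (frameD_ne V) (dW S) (dW_real S) (dW_ne S)
        (dW' S) (dW'_real S) (dW'_ne S) S.isoGL (isoGL_hg₀ S) hGR hGR₂ hGR₃ (1, CMCenter (L : Type) (lineVec (L : Type) (dW' S 1)) u) :=
  rfl

/-! ### § 2. (iii)_∞: the archimedean torus element acts through the archimedean factor -/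

/-- **(iii)_∞ for line 0, OPERATOR form**: `lineRepOf 0 (1, (t_∞,1)) = (c₀((t_∞,1)♭) • ω_∞,0(t_∞ · 1_V, 1)) ⊗ 1` on `𝒮(𝔸_{L⁺}^3)`. -/
theorem lineRepOf_zero_one_inf_eq_adelicTensorEnd
    (t : ↥(Literature.NumberTheory.Automorphic.relNormOneInfUnits (↥(maximalRealSubfield L)) L)) :
    lineRepOf V S hGR hGR₀ hGR₁ hGR₂ hGR₃ η₀ η₁ η₂ η₃ 0
        (1, Literature.NumberTheory.Automorphic.relNormOneInfToIdeles (↥(maximalRealSubfield L)) L t) =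
      adelicTensorEnd
        (((torusScalar_zeroG V S hGR hGR₀ hGR₁ η₀
              ((cmAdelicOneEquivRelNormOne (L : Type)).symm
                (Literature.NumberTheory.Automorphic.relNormOneInfToIdeles (↥(maximalRealSubfield L)) L t)) : ℂˣ) : ℂ) •
          (cmArchWeilRep (L : Type) e₁ (frameD V) (frameD_real V) (frameD_ne V) (lineVec (L : Type) (dW S 0)) (fun _ => dW_real S 0)
              (fun _ => dW_ne S 0) hGR₀ (cmArchCenter (L : Type) 3 (Matrix.diagonal (frameD V)) t, 1) :
            𝓢((Fin 3 → mixedSpace (↥(maximalRealSubfield L))), ℂ) →ₗ[ℂ] _))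
        LinearMap.id := by
  refine LinearMap.ext fun φ => ?_
  rw [lineRepOf_zero_one_center, cmPairRep_cmCenter_inf_one_eq, adelicTensorEnd_smul_left, LinearMap.smul_apply]
  rfl

/-- **(iii)_∞ for line 1, OPERATOR form**. -/
theorem lineRepOf_one_one_inf_eq_adelicTensorEnd
    (t : ↥(Literature.NumberTheory.Automorphic.relNormOneInfUnits (↥(maximalRealSubfield L)) L)) :
    lineRepOf V S hGR hGR₀ hGR₁ hGR₂ hGR₃ η₀ η₁ η₂ η₃ 1
        (1, Literature.NumberTheory.Automorphic.relNormOneInfToIdeles (↥(maximalRealSubfield L)) L t) =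
      adelicTensorEnd
        (((torusScalar_oneG V S hGR hGR₀ hGR₁ η₁
              ((cmAdelicOneEquivRelNormOne (L : Type)).symm
                (Literature.NumberTheory.Automorphic.relNormOneInfToIdeles (↥(maximalRealSubfield L)) L t)) : ℂˣ) : ℂ) •
          (cmArchWeilRep (L : Type) e₁ (frameD V) (frameD_real V) (frameD_ne V) (lineVec (L : Type) (dW S 1)) (fun _ => dW_real S 1)
              (fun _ => dW_ne S 1) hGR₁ (cmArchCenter (L : Type) 3 (Matrix.diagonal (frameD V)) t, 1) :
            𝓢((Fin 3 → mixedSpace (↥(maximalRealSubfield L))), ℂ) →ₗ[ℂ] _))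
        LinearMap.id := by
  refine LinearMap.ext fun φ => ?_
  rw [lineRepOf_one_one_center, cmPairRep_cmCenter_inf_one_eq, adelicTensorEnd_smul_left, LinearMap.smul_apply]
  rfl

/-- **(iii)_∞ for line 2, OPERATOR form**. -/
theorem lineRepOf_two_one_inf_eq_adelicTensorEnd
    (t : ↥(Literature.NumberTheory.Automorphic.relNormOneInfUnits (↥(maximalRealSubfield L)) L)) :
    lineRepOf V S hGR hGR₀ hGR₁ hGR₂ hGR₃ η₀ η₁ η₂ η₃ 2
        (1, Literature.NumberTheory.Automorphic.relNormOneInfToIdeles (↥(maximalRealSubfield L)) L t) =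
      adelicTensorEnd
        (((torusScalar_twoG V S hGR hGR₂ hGR₃ η₂
              ((cmAdelicOneEquivRelNormOne (L : Type)).symm
                (Literature.NumberTheory.Automorphic.relNormOneInfToIdeles (↥(maximalRealSubfield L)) L t)) : ℂˣ) : ℂ) •
          (cmArchWeilRep (L : Type) e₁ (frameD V) (frameD_real V) (frameD_ne V) (lineVec (L : Type) (dW' S 0)) (fun _ => dW'_real S 0)
              (fun _ => dW'_ne S 0) hGR₂ (cmArchCenter (L : Type) 3 (Matrix.diagonal (frameD V)) t, 1) :
            𝓢((Fin 3 → mixedSpace (↥(maximalRealSubfield L))), ℂ) →ₗ[ℂ] _))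
        LinearMap.id := by
  refine LinearMap.ext fun φ => ?_
  rw [lineRepOf_two_one_center, cmPairRep_cmCenter_inf_one_eq, adelicTensorEnd_smul_left, LinearMap.smul_apply]
  rfl

/-- **(iii)_∞ for line 3, OPERATOR form**. -/
theorem lineRepOf_three_one_inf_eq_adelicTensorEnd
    (t : ↥(Literature.NumberTheory.Automorphic.relNormOneInfUnits (↥(maximalRealSubfield L)) L)) :
    lineRepOf V S hGR hGR₀ hGR₁ hGR₂ hGR₃ η₀ η₁ η₂ η₃ 3
        (1, Literature.NumberTheory.Automorphic.relNormOneInfToIdeles (↥(maximalRealSubfield L)) L t) =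
      adelicTensorEnd
        (((torusScalar_threeG V S hGR hGR₂ hGR₃ η₃
              ((cmAdelicOneEquivRelNormOne (L : Type)).symm
                (Literature.NumberTheory.Automorphic.relNormOneInfToIdeles (↥(maximalRealSubfield L)) L t)) : ℂˣ) : ℂ) •
          (cmArchWeilRep (L : Type) e₁ (frameD V) (frameD_real V) (frameD_ne V) (lineVec (L : Type) (dW' S 1)) (fun _ => dW'_real S 1)
              (fun _ => dW'_ne S 1) hGR₃ (cmArchCenter (L : Type) 3 (Matrix.diagonal (frameD V)) t, 1) :
            𝓢((Fin 3 → mixedSpace (↥(maximalRealSubfield L))), ℂ) →ₗ[ℂ] _))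
        LinearMap.id := by
  refine LinearMap.ext fun φ => ?_
  rw [lineRepOf_three_one_center, cmPairRep_cmCenter_inf_one_eq, adelicTensorEnd_smul_left, LinearMap.smul_apply]
  rfl

/-- **(iii)_∞ for line 0 on pure tensors**: `lineRepOf 0 (1, (t_∞,1)) (Φ_∞ ⊗ Φ_f) = (c₀ • ω_∞,0(t_∞ · 1_V, 1) Φ_∞) ⊗ Φ_f` for EVERY `Φ_f`. -/
theorem lineRepOf_zero_one_inf_apply_tmul
    (t : ↥(Literature.NumberTheory.Automorphic.relNormOneInfUnits (↥(maximalRealSubfield L)) L))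
    (Φinf : 𝓢((Fin 3 → mixedSpace (↥(maximalRealSubfield L))), ℂ)) (Φfin : FinSB (↥(maximalRealSubfield L)) (Fin 3)) :
    lineRepOf V S hGR hGR₀ hGR₁ hGR₂ hGR₃ η₀ η₁ η₂ η₃ 0
        (1, Literature.NumberTheory.Automorphic.relNormOneInfToIdeles (↥(maximalRealSubfield L)) L t)
        (piSchwartzBruhatEquiv (↥(maximalRealSubfield L)) (Fin 3) (Φinf ⊗ₜ Φfin)) =
      piSchwartzBruhatEquiv (↥(maximalRealSubfield L)) (Fin 3)
        ((((torusScalar_zeroG V S hGR hGR₀ hGR₁ η₀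
              ((cmAdelicOneEquivRelNormOne (L : Type)).symm
                (Literature.NumberTheory.Automorphic.relNormOneInfToIdeles (↥(maximalRealSubfield L)) L t)) : ℂˣ) : ℂ) •
            cmArchWeilRep (L : Type) e₁ (frameD V) (frameD_real V) (frameD_ne V) (lineVec (L : Type) (dW S 0)) (fun _ => dW_real S 0)
              (fun _ => dW_ne S 0) hGR₀ (cmArchCenter (L : Type) 3 (Matrix.diagonal (frameD V)) t, 1) Φinf) ⊗ₜ Φfin) := by
  rw [lineRepOf_zero_one_inf_eq_adelicTensorEnd, adelicTensorEnd_apply_tmul, LinearMap.smul_apply, LinearMap.id_apply]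

/-- **(iii)_∞ for line 1 on pure tensors**. -/
theorem lineRepOf_one_one_inf_apply_tmul
    (t : ↥(Literature.NumberTheory.Automorphic.relNormOneInfUnits (↥(maximalRealSubfield L)) L))
    (Φinf : 𝓢((Fin 3 → mixedSpace (↥(maximalRealSubfield L))), ℂ)) (Φfin : FinSB (↥(maximalRealSubfield L)) (Fin 3)) :
    lineRepOf V S hGR hGR₀ hGR₁ hGR₂ hGR₃ η₀ η₁ η₂ η₃ 1
        (1, Literature.NumberTheory.Automorphic.relNormOneInfToIdeles (↥(maximalRealSubfield L)) L t)
        (piSchwartzBruhatEquiv (↥(maximalRealSubfield L)) (Fin 3) (Φinf ⊗ₜ Φfin)) =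
      piSchwartzBruhatEquiv (↥(maximalRealSubfield L)) (Fin 3)
        ((((torusScalar_oneG V S hGR hGR₀ hGR₁ η₁
              ((cmAdelicOneEquivRelNormOne (L : Type)).symm
                (Literature.NumberTheory.Automorphic.relNormOneInfToIdeles (↥(maximalRealSubfield L)) L t)) : ℂˣ) : ℂ) •
            cmArchWeilRep (L : Type) e₁ (frameD V) (frameD_real V) (frameD_ne V) (lineVec (L : Type) (dW S 1)) (fun _ => dW_real S 1)
              (fun _ => dW_ne S 1) hGR₁ (cmArchCenter (L : Type) 3 (Matrix.diagonal (frameD V)) t, 1) Φinf) ⊗ₜ Φfin) := by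
  rw [lineRepOf_one_one_inf_eq_adelicTensorEnd, adelicTensorEnd_apply_tmul, LinearMap.smul_apply, LinearMap.id_apply]

/-- **(iii)_∞ for line 2 on pure tensors**. -/
theorem lineRepOf_two_one_inf_apply_tmul
    (t : ↥(Literature.NumberTheory.Automorphic.relNormOneInfUnits (↥(maximalRealSubfield L)) L))
    (Φinf : 𝓢((Fin 3 → mixedSpace (↥(maximalRealSubfield L))), ℂ)) (Φfin : FinSB (↥(maximalRealSubfield L)) (Fin 3)) :
    lineRepOf V S hGR hGR₀ hGR₁ hGR₂ hGR₃ η₀ η₁ η₂ η₃ 2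
        (1, Literature.NumberTheory.Automorphic.relNormOneInfToIdeles (↥(maximalRealSubfield L)) L t)
        (piSchwartzBruhatEquiv (↥(maximalRealSubfield L)) (Fin 3) (Φinf ⊗ₜ Φfin)) =
      piSchwartzBruhatEquiv (↥(maximalRealSubfield L)) (Fin 3)
        ((((torusScalar_twoG V S hGR hGR₂ hGR₃ η₂
              ((cmAdelicOneEquivRelNormOne (L : Type)).symm
                (Literature.NumberTheory.Automorphic.relNormOneInfToIdeles (↥(maximalRealSubfield L)) L t)) : ℂˣ) : ℂ) •
            cmArchWeilRep (L : Type) e₁ (frameD V) (frameD_real V) (frameD_ne V) (lineVec (L : Type) (dW' S 0)) (fun _ => dW'_real S 0)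
              (fun _ => dW'_ne S 0) hGR₂ (cmArchCenter (L : Type) 3 (Matrix.diagonal (frameD V)) t, 1) Φinf) ⊗ₜ Φfin) := by
  rw [lineRepOf_two_one_inf_eq_adelicTensorEnd, adelicTensorEnd_apply_tmul, LinearMap.smul_apply, LinearMap.id_apply]

/-- **(iii)_∞ for line 3 on pure tensors**. -/
theorem lineRepOf_three_one_inf_apply_tmul
    (t : ↥(Literature.NumberTheory.Automorphic.relNormOneInfUnits (↥(maximalRealSubfield L)) L))
    (Φinf : 𝓢((Fin 3 → mixedSpace (↥(maximalRealSubfield L))), ℂ)) (Φfin : FinSB (↥(maximalRealSubfield L)) (Fin 3)) :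
    lineRepOf V S hGR hGR₀ hGR₁ hGR₂ hGR₃ η₀ η₁ η₂ η₃ 3
        (1, Literature.NumberTheory.Automorphic.relNormOneInfToIdeles (↥(maximalRealSubfield L)) L t)
        (piSchwartzBruhatEquiv (↥(maximalRealSubfield L)) (Fin 3) (Φinf ⊗ₜ Φfin)) =
      piSchwartzBruhatEquiv (↥(maximalRealSubfield L)) (Fin 3)
        ((((torusScalar_threeG V S hGR hGR₂ hGR₃ η₃
              ((cmAdelicOneEquivRelNormOne (L : Type)).symm
                (Literature.NumberTheory.Automorphic.relNormOneInfToIdeles (↥(maximalRealSubfield L)) L t)) : ℂˣ) : ℂ) •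
            cmArchWeilRep (L : Type) e₁ (frameD V) (frameD_real V) (frameD_ne V) (lineVec (L : Type) (dW' S 1)) (fun _ => dW'_real S 1)
              (fun _ => dW'_ne S 1) hGR₃ (cmArchCenter (L : Type) 3 (Matrix.diagonal (frameD V)) t, 1) Φinf) ⊗ₜ Φfin) := by
  rw [lineRepOf_three_one_inf_eq_adelicTensorEnd, adelicTensorEnd_apply_tmul, LinearMap.smul_apply, LinearMap.id_apply]

end Torus

/-! ### § 3. The archimedean torus weight of the honest harmonic family, for every `Φ_f` -/

section Family

variable (d : (L : Type)) (hd : IsCMField.complexConj L d = d) (hd0 : d ≠ 0)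
  (hGRd : (cmSplittingDatum (L : Type) (e₁) (frameD V) (frameD_real V) (frameD_ne V) (lineVec (L : Type) d) (fun _ => hd)
    (fun _ => hd0)).CompatibleSplitting)
  {S' : Type} [Fintype S'] [DecidableEq S']
  (eR : PosIdx (cmXW (L : Type) (frameD V) (lineVec (L : Type) d) (fun _ => hd) ι₁ (HypCensus.cmPlace (L : Type) ι₁)) ≃ Unit)
  (eS : NegIdx (cmXW (L : Type) (frameD V) (lineVec (L : Type) d) (fun _ => hd) ι₁ (HypCensus.cmPlace (L : Type) ι₁)) ≃ S')

/-- **the archimedean centre `t_∞ · 1_V` acts on EVERY member of the line's slot family by theta-3's eigenvalue `lineC … t_∞ =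
χ(t_∞) · ι_{w(v₁)}(t_∞)`** (carch #CA13 `blockFamilyOfAt … (degOnePDual S') (binvPi 1) ℓ`; `ℓ = ⟨e₀, ·⟩`, `S' = Empty` is theta-3's `linePhi`,
for which this is `cmArchWeilRep_center_linePhi`). -/
theorem cmArchWeilRep_center_blockFamilyOfAt
    (t : ↥(Literature.NumberTheory.Automorphic.relNormOneInfUnits (↥(maximalRealSubfield L)) L)) (ℓ : Module.Dual ℂ (Fin 2 → ℂ)) :
    cmArchWeilRep (L : Type) e₁ (frameD V) (frameD_real V) (frameD_ne V) (lineVec (L : Type) d) (fun _ => hd) (fun _ => hd0) hGRd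
        (cmArchCenter (L : Type) 3 (Matrix.diagonal (frameD V)) t, 1)
        (blockFamilyOfAt (L : Type) e₁ (frameD V) (frameD_real V) (frameD_ne V) (lineVec (L : Type) d) (fun _ => hd) (fun _ => hd0) ι₁
          (blockPosEquiv V) (blockNegEquiv V) eR eS (degOnePDual S') (binvPi 1) ℓ) =
      lineC V d hd hd0 hGRd t •
        blockFamilyOfAt (L : Type) e₁ (frameD V) (frameD_real V) (frameD_ne V) (lineVec (L : Type) d) (fun _ => hd) (fun _ => hd0) ι₁
          (blockPosEquiv V) (blockNegEquiv V) eR eS (degOnePDual S') (binvPi 1) ℓ := by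
  obtain ⟨b, rfl⟩ : ∃ b : Fin 2 → ℂ, dotProductEquiv ℂ (Fin 2) b = ℓ :=
    ⟨(dotProductEquiv ℂ (Fin 2)).symm ℓ, LinearEquiv.apply_symm_apply _ _⟩
  rw [blockFamilyOfAt_degOnePDual_binvPi_one, lineC_def]
  exact cmArchWeilRep_center_follandFock_linePlacePoly S' (L : Type) e₁ (frameD V) (frameD_real V) (frameD_ne V) (lineVec (L : Type) d)
    (fun _ => hd) (fun _ => hd0) hGRd ι₁ (blockPosEquiv V) (blockNegEquiv V) eR eS (lineCenterChar V d hd hd0 hGRd)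
    (lineCenterChar_spec V d hd hd0 hGRd) t b

end Family

section FamilyWeight

variable
  (hGR : (cmSplittingDatum (L : Type) finProdFinEquiv (frameD V) (frameD_real V) (frameD_ne V) (dW S) (dW_real S) (dW_ne S)).CompatibleSplitting)
  (hGR₀ : (cmSplittingDatum (L : Type) (e₁) (frameD V) (frameD_real V) (frameD_ne V) (lineVec (L : Type) (dW S 0))
    (fun _ => dW_real S 0) (fun _ => dW_ne S 0)).CompatibleSplitting)
  (hGR₁ : (cmSplittingDatum (L : Type) (e₁) (frameD V) (frameD_real V) (frameD_ne V) (lineVec (L : Type) (dW S 1))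
    (fun _ => dW_real S 1) (fun _ => dW_ne S 1)).CompatibleSplitting)
  (hGR₂ : (cmSplittingDatum (L : Type) (e₁) (frameD V) (frameD_real V) (frameD_ne V) (lineVec (L : Type) (dW' S 0))
    (fun _ => dW'_real S 0) (fun _ => dW'_ne S 0)).CompatibleSplitting)
  (hGR₃ : (cmSplittingDatum (L : Type) (e₁) (frameD V) (frameD_real V) (frameD_ne V) (lineVec (L : Type) (dW' S 1))
    (fun _ => dW'_real S 1) (fun _ => dW'_ne S 1)).CompatibleSplitting)
  (η₀ η₁ η₂ η₃ : CMAdelic (L : Type) (frameD V) × CMAdelicOne (L : Type) →* ℂˣ)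
  {S' : Type} [Fintype S'] [DecidableEq S']

/-- **the archimedean torus on `Φ_∞,0(ℓ) ⊗ Φ_f`, line 0**: `lineRepOf 0 (1, (t_∞,1)) (Φ_∞,0(ℓ) ⊗ Φ_f) = (c₀ · lineC₀)(t_∞) • (Φ_∞,0(ℓ) ⊗ Φ_f)`
for EVERY covector `ℓ` of the slot family and EVERY finite test function `Φ_f`. -/
theorem lineRepOf_zero_one_inf_blockFamily_tmul
    (eR : PosIdx (cmXW (L : Type) (frameD V) (lineVec (L : Type) (dW S 0)) (fun _ => dW_real S 0) ι₁ (HypCensus.cmPlace (L : Type) ι₁)) ≃ Unit)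
    (eS : NegIdx (cmXW (L : Type) (frameD V) (lineVec (L : Type) (dW S 0)) (fun _ => dW_real S 0) ι₁ (HypCensus.cmPlace (L : Type) ι₁)) ≃ S')
    (t : ↥(Literature.NumberTheory.Automorphic.relNormOneInfUnits (↥(maximalRealSubfield L)) L)) (ℓ : Module.Dual ℂ (Fin 2 → ℂ))
    (Φfin : FinSB (↥(maximalRealSubfield L)) (Fin 3)) :
    lineRepOf V S hGR hGR₀ hGR₁ hGR₂ hGR₃ η₀ η₁ η₂ η₃ 0
        (1, Literature.NumberTheory.Automorphic.relNormOneInfToIdeles (↥(maximalRealSubfield L)) L t)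
        (piSchwartzBruhatEquiv (↥(maximalRealSubfield L)) (Fin 3)
          (blockFamilyOfAt (L : Type) e₁ (frameD V) (frameD_real V) (frameD_ne V) (lineVec (L : Type) (dW S 0)) (fun _ => dW_real S 0)
            (fun _ => dW_ne S 0) ι₁ (blockPosEquiv V) (blockNegEquiv V) eR eS (degOnePDual S') (binvPi 1) ℓ ⊗ₜ Φfin)) =
      (((torusScalar_zeroG V S hGR hGR₀ hGR₁ η₀
            ((cmAdelicOneEquivRelNormOne (L : Type)).symm
              (Literature.NumberTheory.Automorphic.relNormOneInfToIdeles (↥(maximalRealSubfield L)) L t)) : ℂˣ) : ℂ) *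
          lineC V (dW S 0) (dW_real S 0) (dW_ne S 0) hGR₀ t) •
        piSchwartzBruhatEquiv (↥(maximalRealSubfield L)) (Fin 3)
          (blockFamilyOfAt (L : Type) e₁ (frameD V) (frameD_real V) (frameD_ne V) (lineVec (L : Type) (dW S 0)) (fun _ => dW_real S 0)
            (fun _ => dW_ne S 0) ι₁ (blockPosEquiv V) (blockNegEquiv V) eR eS (degOnePDual S') (binvPi 1) ℓ ⊗ₜ Φfin) := by
  rw [lineRepOf_zero_one_inf_apply_tmul, cmArchWeilRep_center_blockFamilyOfAt, smul_smul, ← TensorProduct.smul_tmul', map_smul]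

/-- **the archimedean torus on `Φ_∞,1(ℓ) ⊗ Φ_f`, line 1**. -/
theorem lineRepOf_one_one_inf_blockFamily_tmul
    (eR : PosIdx (cmXW (L : Type) (frameD V) (lineVec (L : Type) (dW S 1)) (fun _ => dW_real S 1) ι₁ (HypCensus.cmPlace (L : Type) ι₁)) ≃ Unit)
    (eS : NegIdx (cmXW (L : Type) (frameD V) (lineVec (L : Type) (dW S 1)) (fun _ => dW_real S 1) ι₁ (HypCensus.cmPlace (L : Type) ι₁)) ≃ S')
    (t : ↥(Literature.NumberTheory.Automorphic.relNormOneInfUnits (↥(maximalRealSubfield L)) L)) (ℓ : Module.Dual ℂ (Fin 2 → ℂ))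
    (Φfin : FinSB (↥(maximalRealSubfield L)) (Fin 3)) :
    lineRepOf V S hGR hGR₀ hGR₁ hGR₂ hGR₃ η₀ η₁ η₂ η₃ 1
        (1, Literature.NumberTheory.Automorphic.relNormOneInfToIdeles (↥(maximalRealSubfield L)) L t)
        (piSchwartzBruhatEquiv (↥(maximalRealSubfield L)) (Fin 3)
          (blockFamilyOfAt (L : Type) e₁ (frameD V) (frameD_real V) (frameD_ne V) (lineVec (L : Type) (dW S 1)) (fun _ => dW_real S 1)
            (fun _ => dW_ne S 1) ι₁ (blockPosEquiv V) (blockNegEquiv V) eR eS (degOnePDual S') (binvPi 1) ℓ ⊗ₜ Φfin)) =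
      (((torusScalar_oneG V S hGR hGR₀ hGR₁ η₁
            ((cmAdelicOneEquivRelNormOne (L : Type)).symm
              (Literature.NumberTheory.Automorphic.relNormOneInfToIdeles (↥(maximalRealSubfield L)) L t)) : ℂˣ) : ℂ) *
          lineC V (dW S 1) (dW_real S 1) (dW_ne S 1) hGR₁ t) •
        piSchwartzBruhatEquiv (↥(maximalRealSubfield L)) (Fin 3)
          (blockFamilyOfAt (L : Type) e₁ (frameD V) (frameD_real V) (frameD_ne V) (lineVec (L : Type) (dW S 1)) (fun _ => dW_real S 1)
            (fun _ => dW_ne S 1) ι₁ (blockPosEquiv V) (blockNegEquiv V) eR eS (degOnePDual S') (binvPi 1) ℓ ⊗ₜ Φfin) := by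
  rw [lineRepOf_one_one_inf_apply_tmul, cmArchWeilRep_center_blockFamilyOfAt, smul_smul, ← TensorProduct.smul_tmul', map_smul]

/-- **the archimedean torus on `Φ_∞,2(ℓ) ⊗ Φ_f`, line 2**. -/
theorem lineRepOf_two_one_inf_blockFamily_tmul
    (eR : PosIdx (cmXW (L : Type) (frameD V) (lineVec (L : Type) (dW' S 0)) (fun _ => dW'_real S 0) ι₁ (HypCensus.cmPlace (L : Type) ι₁)) ≃ Unit)
    (eS : NegIdx (cmXW (L : Type) (frameD V) (lineVec (L : Type) (dW' S 0)) (fun _ => dW'_real S 0) ι₁ (HypCensus.cmPlace (L : Type) ι₁)) ≃ S')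
    (t : ↥(Literature.NumberTheory.Automorphic.relNormOneInfUnits (↥(maximalRealSubfield L)) L)) (ℓ : Module.Dual ℂ (Fin 2 → ℂ))
    (Φfin : FinSB (↥(maximalRealSubfield L)) (Fin 3)) :
    lineRepOf V S hGR hGR₀ hGR₁ hGR₂ hGR₃ η₀ η₁ η₂ η₃ 2
        (1, Literature.NumberTheory.Automorphic.relNormOneInfToIdeles (↥(maximalRealSubfield L)) L t)
        (piSchwartzBruhatEquiv (↥(maximalRealSubfield L)) (Fin 3)
          (blockFamilyOfAt (L : Type) e₁ (frameD V) (frameD_real V) (frameD_ne V) (lineVec (L : Type) (dW' S 0)) (fun _ => dW'_real S 0)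
            (fun _ => dW'_ne S 0) ι₁ (blockPosEquiv V) (blockNegEquiv V) eR eS (degOnePDual S') (binvPi 1) ℓ ⊗ₜ Φfin)) =
      (((torusScalar_twoG V S hGR hGR₂ hGR₃ η₂
            ((cmAdelicOneEquivRelNormOne (L : Type)).symm
              (Literature.NumberTheory.Automorphic.relNormOneInfToIdeles (↥(maximalRealSubfield L)) L t)) : ℂˣ) : ℂ) *
          lineC V (dW' S 0) (dW'_real S 0) (dW'_ne S 0) hGR₂ t) •
        piSchwartzBruhatEquiv (↥(maximalRealSubfield L)) (Fin 3)
          (blockFamilyOfAt (L : Type) e₁ (frameD V) (frameD_real V) (frameD_ne V) (lineVec (L : Type) (dW' S 0)) (fun _ => dW'_real S 0)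
            (fun _ => dW'_ne S 0) ι₁ (blockPosEquiv V) (blockNegEquiv V) eR eS (degOnePDual S') (binvPi 1) ℓ ⊗ₜ Φfin) := by
  rw [lineRepOf_two_one_inf_apply_tmul, cmArchWeilRep_center_blockFamilyOfAt, smul_smul, ← TensorProduct.smul_tmul', map_smul]

/-- **the archimedean torus on `Φ_∞,3(ℓ) ⊗ Φ_f`, line 3**. -/
theorem lineRepOf_three_one_inf_blockFamily_tmul
    (eR : PosIdx (cmXW (L : Type) (frameD V) (lineVec (L : Type) (dW' S 1)) (fun _ => dW'_real S 1) ι₁ (HypCensus.cmPlace (L : Type) ι₁)) ≃ Unit)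
    (eS : NegIdx (cmXW (L : Type) (frameD V) (lineVec (L : Type) (dW' S 1)) (fun _ => dW'_real S 1) ι₁ (HypCensus.cmPlace (L : Type) ι₁)) ≃ S')
    (t : ↥(Literature.NumberTheory.Automorphic.relNormOneInfUnits (↥(maximalRealSubfield L)) L)) (ℓ : Module.Dual ℂ (Fin 2 → ℂ))
    (Φfin : FinSB (↥(maximalRealSubfield L)) (Fin 3)) :
    lineRepOf V S hGR hGR₀ hGR₁ hGR₂ hGR₃ η₀ η₁ η₂ η₃ 3
        (1, Literature.NumberTheory.Automorphic.relNormOneInfToIdeles (↥(maximalRealSubfield L)) L t)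
        (piSchwartzBruhatEquiv (↥(maximalRealSubfield L)) (Fin 3)
          (blockFamilyOfAt (L : Type) e₁ (frameD V) (frameD_real V) (frameD_ne V) (lineVec (L : Type) (dW' S 1)) (fun _ => dW'_real S 1)
            (fun _ => dW'_ne S 1) ι₁ (blockPosEquiv V) (blockNegEquiv V) eR eS (degOnePDual S') (binvPi 1) ℓ ⊗ₜ Φfin)) =
      (((torusScalar_threeG V S hGR hGR₂ hGR₃ η₃
            ((cmAdelicOneEquivRelNormOne (L : Type)).symm
              (Literature.NumberTheory.Automorphic.relNormOneInfToIdeles (↥(maximalRealSubfield L)) L t)) : ℂˣ) : ℂ) *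
          lineC V (dW' S 1) (dW'_real S 1) (dW'_ne S 1) hGR₃ t) •
        piSchwartzBruhatEquiv (↥(maximalRealSubfield L)) (Fin 3)
          (blockFamilyOfAt (L : Type) e₁ (frameD V) (frameD_real V) (frameD_ne V) (lineVec (L : Type) (dW' S 1)) (fun _ => dW'_real S 1)
            (fun _ => dW'_ne S 1) ι₁ (blockPosEquiv V) (blockNegEquiv V) eR eS (degOnePDual S') (binvPi 1) ℓ ⊗ₜ Φfin) := by
  rw [lineRepOf_three_one_inf_apply_tmul, cmArchWeilRep_center_blockFamilyOfAt, smul_smul, ← TensorProduct.smul_tmul', map_smul]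


/-- **(W-wt) for the whole family and every `Φ_f`, line 0**: under the (J-μ)₀ identity of `ArchLineDatum` (the hypothesis `hμ₀` of
theta-3's `archLineDatumOf`, verbatim) the default-split line representation `lineRepD … η 0` has archimedean torus weight
`archWeight L μ₀` on EVERY `Φ_∞,0(ℓ) ⊗ Φ_f`: `lineRepD 0 (1, (t_∞,1)) (Φ_∞,0(ℓ) ⊗ Φ_f) = archWeight L μ₀ t_∞ • (Φ_∞,0(ℓ) ⊗ Φ_f)`
(the `WeilPairData.weight` field of the honest term, freed from `Φ_f = 1_{x₀ + N𝒪̂}`). -/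
theorem lineRepD_zero_one_inf_blockFamily_tmul (η : CMAdelic (L : Type) (frameD V) × CMAdelic (L : Type) (dW S) →* ℂˣ)
    (μ₀ : InfinitePlace (L : Type) → ℤ)
    (hμ₀ : ∀ t : ↥(Literature.NumberTheory.Automorphic.relNormOneInfUnits (↥(maximalRealSubfield L)) L),
      ((eta₀ V S η (1, (cmAdelicOneEquivRelNormOne (L : Type)).symm
            (Literature.NumberTheory.Automorphic.relNormOneInfToIdeles (↥(maximalRealSubfield L)) L t)) *
              cmLineChar₀ (L : Type) finProdFinEquiv e₁ (frameD V) (frameD_real V) (frameD_ne V) (dW S) (dW_real S) (dW_ne S)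
                hGR hGR₀ hGR₁
                (1, CMCenter (L : Type) (lineVec (L : Type) (dW S 0))
                  ((cmAdelicOneEquivRelNormOne (L : Type)).symm
                    (Literature.NumberTheory.Automorphic.relNormOneInfToIdeles (↥(maximalRealSubfield L)) L t))) :
            ℂˣ) : ℂ) * lineC V (dW S 0) (dW_real S 0) (dW_ne S 0) hGR₀ t =
        Literature.NumberTheory.Automorphic.archWeight (L : Type) μ₀ t)
    (eR : PosIdx (cmXW (L : Type) (frameD V) (lineVec (L : Type) (dW S 0)) (fun _ => dW_real S 0) ι₁ (HypCensus.cmPlace (L : Type) ι₁)) ≃ Unit)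
    (eS : NegIdx (cmXW (L : Type) (frameD V) (lineVec (L : Type) (dW S 0)) (fun _ => dW_real S 0) ι₁ (HypCensus.cmPlace (L : Type) ι₁)) ≃ S')
    (t : ↥(Literature.NumberTheory.Automorphic.relNormOneInfUnits (↥(maximalRealSubfield L)) L)) (ℓ : Module.Dual ℂ (Fin 2 → ℂ))
    (Φfin : FinSB (↥(maximalRealSubfield L)) (Fin 3)) :
    lineRepD V S hGR hGR₀ hGR₁ hGR₂ hGR₃ η 0
        (1, Literature.NumberTheory.Automorphic.relNormOneInfToIdeles (↥(maximalRealSubfield L)) L t)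
        (piSchwartzBruhatEquiv (↥(maximalRealSubfield L)) (Fin 3)
          (blockFamilyOfAt (L : Type) e₁ (frameD V) (frameD_real V) (frameD_ne V) (lineVec (L : Type) (dW S 0)) (fun _ => dW_real S 0)
            (fun _ => dW_ne S 0) ι₁ (blockPosEquiv V) (blockNegEquiv V) eR eS (degOnePDual S') (binvPi 1) ℓ ⊗ₜ Φfin)) =
      Literature.NumberTheory.Automorphic.archWeight (L : Type) μ₀ t •
        piSchwartzBruhatEquiv (↥(maximalRealSubfield L)) (Fin 3)
          (blockFamilyOfAt (L : Type) e₁ (frameD V) (frameD_real V) (frameD_ne V) (lineVec (L : Type) (dW S 0)) (fun _ => dW_real S 0)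
            (fun _ => dW_ne S 0) ι₁ (blockPosEquiv V) (blockNegEquiv V) eR eS (degOnePDual S') (binvPi 1) ℓ ⊗ₜ Φfin) := by
  rw [← hμ₀ t]
  exact lineRepOf_zero_one_inf_blockFamily_tmul V S hGR hGR₀ hGR₁ hGR₂ hGR₃ (eta₀ V S η) (eta₁ V S η) (eta₂ V S η) (eta₃ V S η)
    eR eS t ℓ Φfin

/-- **(W-wt) for the whole family and every `Φ_f`, line 1**: under the (J-μ)₁ identity of `ArchLineDatum` (the hypothesis `hμ₁` of
theta-3's `archLineDatumOf`, verbatim) the default-split line representation `lineRepD … η 1` has archimedean torus weight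
`archWeight L μ₁` on EVERY `Φ_∞,1(ℓ) ⊗ Φ_f`: `lineRepD 1 (1, (t_∞,1)) (Φ_∞,1(ℓ) ⊗ Φ_f) = archWeight L μ₁ t_∞ • (Φ_∞,1(ℓ) ⊗ Φ_f)`
(the `WeilPairData.weight` field of the honest term, freed from `Φ_f = 1_{x₀ + N𝒪̂}`). -/
theorem lineRepD_one_one_inf_blockFamily_tmul (η : CMAdelic (L : Type) (frameD V) × CMAdelic (L : Type) (dW S) →* ℂˣ)
    (μ₁ : InfinitePlace (L : Type) → ℤ)
    (hμ₁ : ∀ t : ↥(Literature.NumberTheory.Automorphic.relNormOneInfUnits (↥(maximalRealSubfield L)) L),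
      ((eta₁ V S η (1, (cmAdelicOneEquivRelNormOne (L : Type)).symm
            (Literature.NumberTheory.Automorphic.relNormOneInfToIdeles (↥(maximalRealSubfield L)) L t)) *
              cmLineChar₁ (L : Type) finProdFinEquiv e₁ (frameD V) (frameD_real V) (frameD_ne V) (dW S) (dW_real S) (dW_ne S)
                hGR hGR₀ hGR₁
                (1, CMCenter (L : Type) (lineVec (L : Type) (dW S 1))
                  ((cmAdelicOneEquivRelNormOne (L : Type)).symm
                    (Literature.NumberTheory.Automorphic.relNormOneInfToIdeles (↥(maximalRealSubfield L)) L t))) :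
            ℂˣ) : ℂ) * lineC V (dW S 1) (dW_real S 1) (dW_ne S 1) hGR₁ t =
        Literature.NumberTheory.Automorphic.archWeight (L : Type) μ₁ t)
    (eR : PosIdx (cmXW (L : Type) (frameD V) (lineVec (L : Type) (dW S 1)) (fun _ => dW_real S 1) ι₁ (HypCensus.cmPlace (L : Type) ι₁)) ≃ Unit)
    (eS : NegIdx (cmXW (L : Type) (frameD V) (lineVec (L : Type) (dW S 1)) (fun _ => dW_real S 1) ι₁ (HypCensus.cmPlace (L : Type) ι₁)) ≃ S')
    (t : ↥(Literature.NumberTheory.Automorphic.relNormOneInfUnits (↥(maximalRealSubfield L)) L)) (ℓ : Module.Dual ℂ (Fin 2 → ℂ))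
    (Φfin : FinSB (↥(maximalRealSubfield L)) (Fin 3)) :
    lineRepD V S hGR hGR₀ hGR₁ hGR₂ hGR₃ η 1
        (1, Literature.NumberTheory.Automorphic.relNormOneInfToIdeles (↥(maximalRealSubfield L)) L t)
        (piSchwartzBruhatEquiv (↥(maximalRealSubfield L)) (Fin 3)
          (blockFamilyOfAt (L : Type) e₁ (frameD V) (frameD_real V) (frameD_ne V) (lineVec (L : Type) (dW S 1)) (fun _ => dW_real S 1)
            (fun _ => dW_ne S 1) ι₁ (blockPosEquiv V) (blockNegEquiv V) eR eS (degOnePDual S') (binvPi 1) ℓ ⊗ₜ Φfin)) =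
      Literature.NumberTheory.Automorphic.archWeight (L : Type) μ₁ t •
        piSchwartzBruhatEquiv (↥(maximalRealSubfield L)) (Fin 3)
          (blockFamilyOfAt (L : Type) e₁ (frameD V) (frameD_real V) (frameD_ne V) (lineVec (L : Type) (dW S 1)) (fun _ => dW_real S 1)
            (fun _ => dW_ne S 1) ι₁ (blockPosEquiv V) (blockNegEquiv V) eR eS (degOnePDual S') (binvPi 1) ℓ ⊗ₜ Φfin) := by
  rw [← hμ₁ t]
  exact lineRepOf_one_one_inf_blockFamily_tmul V S hGR hGR₀ hGR₁ hGR₂ hGR₃ (eta₀ V S η) (eta₁ V S η) (eta₂ V S η) (eta₃ V S η)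
    eR eS t ℓ Φfin

/-- **(W-wt) for the whole family and every `Φ_f`, line 2**: under the (J-μ)₂ identity of `ArchLineDatum` (the hypothesis `hμ₂` of
theta-3's `archLineDatumOf`, verbatim) the default-split line representation `lineRepD … η 2` has archimedean torus weight
`archWeight L μ₂` on EVERY `Φ_∞,2(ℓ) ⊗ Φ_f`: `lineRepD 2 (1, (t_∞,1)) (Φ_∞,2(ℓ) ⊗ Φ_f) = archWeight L μ₂ t_∞ • (Φ_∞,2(ℓ) ⊗ Φ_f)`
(the `WeilPairData.weight` field of the honest term, freed from `Φ_f = 1_{x₀ + N𝒪̂}`). -/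
theorem lineRepD_two_one_inf_blockFamily_tmul (η : CMAdelic (L : Type) (frameD V) × CMAdelic (L : Type) (dW S) →* ℂˣ)
    (μ₂ : InfinitePlace (L : Type) → ℤ)
    (hμ₂ : ∀ t : ↥(Literature.NumberTheory.Automorphic.relNormOneInfUnits (↥(maximalRealSubfield L)) L),
      ((eta₂ V S η (1, (cmAdelicOneEquivRelNormOne (L : Type)).symm
            (Literature.NumberTheory.Automorphic.relNormOneInfToIdeles (↥(maximalRealSubfield L)) L t)) *
              cmConjLineChar₀ (L : Type) finProdFinEquiv e₁ (frameD V) (frameD_real V) (frameD_ne V) (dW S) (dW_real S) (dW_ne S)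
                (dW' S) (dW'_real S) (dW'_ne S) S.isoGL (isoGL_hg₀ S) hGR hGR₂ hGR₃
                (1, CMCenter (L : Type) (lineVec (L : Type) (dW' S 0))
                  ((cmAdelicOneEquivRelNormOne (L : Type)).symm
                    (Literature.NumberTheory.Automorphic.relNormOneInfToIdeles (↥(maximalRealSubfield L)) L t))) :
            ℂˣ) : ℂ) * lineC V (dW' S 0) (dW'_real S 0) (dW'_ne S 0) hGR₂ t =
        Literature.NumberTheory.Automorphic.archWeight (L : Type) μ₂ t)
    (eR : PosIdx (cmXW (L : Type) (frameD V) (lineVec (L : Type) (dW' S 0)) (fun _ => dW'_real S 0) ι₁ (HypCensus.cmPlace (L : Type) ι₁)) ≃ Unit)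
    (eS : NegIdx (cmXW (L : Type) (frameD V) (lineVec (L : Type) (dW' S 0)) (fun _ => dW'_real S 0) ι₁ (HypCensus.cmPlace (L : Type) ι₁)) ≃ S')
    (t : ↥(Literature.NumberTheory.Automorphic.relNormOneInfUnits (↥(maximalRealSubfield L)) L)) (ℓ : Module.Dual ℂ (Fin 2 → ℂ))
    (Φfin : FinSB (↥(maximalRealSubfield L)) (Fin 3)) :
    lineRepD V S hGR hGR₀ hGR₁ hGR₂ hGR₃ η 2
        (1, Literature.NumberTheory.Automorphic.relNormOneInfToIdeles (↥(maximalRealSubfield L)) L t)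
        (piSchwartzBruhatEquiv (↥(maximalRealSubfield L)) (Fin 3)
          (blockFamilyOfAt (L : Type) e₁ (frameD V) (frameD_real V) (frameD_ne V) (lineVec (L : Type) (dW' S 0)) (fun _ => dW'_real S 0)
            (fun _ => dW'_ne S 0) ι₁ (blockPosEquiv V) (blockNegEquiv V) eR eS (degOnePDual S') (binvPi 1) ℓ ⊗ₜ Φfin)) =
      Literature.NumberTheory.Automorphic.archWeight (L : Type) μ₂ t •
        piSchwartzBruhatEquiv (↥(maximalRealSubfield L)) (Fin 3)
          (blockFamilyOfAt (L : Type) e₁ (frameD V) (frameD_real V) (frameD_ne V) (lineVec (L : Type) (dW' S 0)) (fun _ => dW'_real S 0)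
            (fun _ => dW'_ne S 0) ι₁ (blockPosEquiv V) (blockNegEquiv V) eR eS (degOnePDual S') (binvPi 1) ℓ ⊗ₜ Φfin) := by
  rw [← hμ₂ t]
  exact lineRepOf_two_one_inf_blockFamily_tmul V S hGR hGR₀ hGR₁ hGR₂ hGR₃ (eta₀ V S η) (eta₁ V S η) (eta₂ V S η) (eta₃ V S η)
    eR eS t ℓ Φfin

/-- **(W-wt) for the whole family and every `Φ_f`, line 3**: under the (J-μ)₃ identity of `ArchLineDatum` (the hypothesis `hμ₃` of
theta-3's `archLineDatumOf`, verbatim) the default-split line representation `lineRepD … η 3` has archimedean torus weight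
`archWeight L μ₃` on EVERY `Φ_∞,3(ℓ) ⊗ Φ_f`: `lineRepD 3 (1, (t_∞,1)) (Φ_∞,3(ℓ) ⊗ Φ_f) = archWeight L μ₃ t_∞ • (Φ_∞,3(ℓ) ⊗ Φ_f)`
(the `WeilPairData.weight` field of the honest term, freed from `Φ_f = 1_{x₀ + N𝒪̂}`). -/
theorem lineRepD_three_one_inf_blockFamily_tmul (η : CMAdelic (L : Type) (frameD V) × CMAdelic (L : Type) (dW S) →* ℂˣ)
    (μ₃ : InfinitePlace (L : Type) → ℤ)
    (hμ₃ : ∀ t : ↥(Literature.NumberTheory.Automorphic.relNormOneInfUnits (↥(maximalRealSubfield L)) L),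
      ((eta₃ V S η (1, (cmAdelicOneEquivRelNormOne (L : Type)).symm
            (Literature.NumberTheory.Automorphic.relNormOneInfToIdeles (↥(maximalRealSubfield L)) L t)) *
              cmConjLineChar₁ (L : Type) finProdFinEquiv e₁ (frameD V) (frameD_real V) (frameD_ne V) (dW S) (dW_real S) (dW_ne S)
                (dW' S) (dW'_real S) (dW'_ne S) S.isoGL (isoGL_hg₀ S) hGR hGR₂ hGR₃
                (1, CMCenter (L : Type) (lineVec (L : Type) (dW' S 1))
                  ((cmAdelicOneEquivRelNormOne (L : Type)).symm
                    (Literature.NumberTheory.Automorphic.relNormOneInfToIdeles (↥(maximalRealSubfield L)) L t))) :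
            ℂˣ) : ℂ) * lineC V (dW' S 1) (dW'_real S 1) (dW'_ne S 1) hGR₃ t =
        Literature.NumberTheory.Automorphic.archWeight (L : Type) μ₃ t)
    (eR : PosIdx (cmXW (L : Type) (frameD V) (lineVec (L : Type) (dW' S 1)) (fun _ => dW'_real S 1) ι₁ (HypCensus.cmPlace (L : Type) ι₁)) ≃ Unit)
    (eS : NegIdx (cmXW (L : Type) (frameD V) (lineVec (L : Type) (dW' S 1)) (fun _ => dW'_real S 1) ι₁ (HypCensus.cmPlace (L : Type) ι₁)) ≃ S')
    (t : ↥(Literature.NumberTheory.Automorphic.relNormOneInfUnits (↥(maximalRealSubfield L)) L)) (ℓ : Module.Dual ℂ (Fin 2 → ℂ))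
    (Φfin : FinSB (↥(maximalRealSubfield L)) (Fin 3)) :
    lineRepD V S hGR hGR₀ hGR₁ hGR₂ hGR₃ η 3
        (1, Literature.NumberTheory.Automorphic.relNormOneInfToIdeles (↥(maximalRealSubfield L)) L t)
        (piSchwartzBruhatEquiv (↥(maximalRealSubfield L)) (Fin 3)
          (blockFamilyOfAt (L : Type) e₁ (frameD V) (frameD_real V) (frameD_ne V) (lineVec (L : Type) (dW' S 1)) (fun _ => dW'_real S 1)
            (fun _ => dW'_ne S 1) ι₁ (blockPosEquiv V) (blockNegEquiv V) eR eS (degOnePDual S') (binvPi 1) ℓ ⊗ₜ Φfin)) =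
      Literature.NumberTheory.Automorphic.archWeight (L : Type) μ₃ t •
        piSchwartzBruhatEquiv (↥(maximalRealSubfield L)) (Fin 3)
          (blockFamilyOfAt (L : Type) e₁ (frameD V) (frameD_real V) (frameD_ne V) (lineVec (L : Type) (dW' S 1)) (fun _ => dW'_real S 1)
            (fun _ => dW'_ne S 1) ι₁ (blockPosEquiv V) (blockNegEquiv V) eR eS (degOnePDual S') (binvPi 1) ℓ ⊗ₜ Φfin) := by
  rw [← hμ₃ t]
  exact lineRepOf_three_one_inf_blockFamily_tmul V S hGR hGR₀ hGR₁ hGR₂ hGR₃ (eta₀ V S η) (eta₁ V S η) (eta₂ V S η) (eta₃ V S η)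
    eR eS t ℓ Φfin

end FamilyWeight

/-! ### § 4. Torus bookkeeping at the finite places: `U(⟨d⟩)(𝔸_{K⁺,f}) → U(1)(𝔸_{K⁺})` and the centre -/

section FinTorus

variable (K : Type) [Field K] [NumberField K] [IsCMField K] (d : K) (hd0 : d ≠ 0)

/-- **the finite torus of the line `⟨d⟩` read in `U(1)(𝔸_{K⁺})`**: `u_f ↦ det (1_∞, u_f)` (tree `cmAdelicDet ∘ finAdelicToAdelic`). -/
def finLineTorus :
    ↥(UnitaryGroup.finAdelic (↥(maximalRealSubfield K)) K (IsCMField.complexConj K) 1 (Matrix.diagonal (lineVec K d))) →*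
      CMAdelicOne K :=
  (cmAdelicDet K (lineVec K d) (fun _ => hd0)).comp
    (UnitaryGroup.finAdelicToAdelic (↥(maximalRealSubfield K)) K (IsCMField.complexConj K) 1 (Matrix.diagonal (lineVec K d)))

/-- (Ported verbatim from the HodgeCMPerL package; no docstring in the source.) -/
theorem finLineTorus_apply
    (uf : ↥(UnitaryGroup.finAdelic (↥(maximalRealSubfield K)) K (IsCMField.complexConj K) 1 (Matrix.diagonal (lineVec K d)))) :
    finLineTorus K d hd0 uf =
      cmAdelicDet K (lineVec K d) (fun _ => hd0)
        (UnitaryGroup.finAdelicToAdelic (↥(maximalRealSubfield K)) K (IsCMField.complexConj K) 1 (Matrix.diagonal (lineVec K d)) uf) :=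
  rfl

/-- **a `1 × 1` adelic unitary matrix is central**: `(det g) · 1₁ = g` in `U(⟨d⟩)(𝔸_{K⁺})` (tree `coe_eq_det_smul_one`). -/
theorem cmCenter_cmAdelicDet_line (g : CMAdelic K (lineVec K d)) :
    CMCenter K (lineVec K d) (cmAdelicDet K (lineVec K d) (fun _ => hd0) g) = g :=
  Subtype.ext (Units.ext
    ((UnitaryGroup.coe_adelicCenter (↥(maximalRealSubfield K)) K (IsCMField.complexConj K) 1 (Matrix.diagonal (lineVec K d)) _).trans
      (UnitaryGroup.coe_eq_det_smul_one K _).symm))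

/-- **the centre of the line at `finLineTorus u_f` IS `(1_∞, u_f)`**: `CMCenter ⟨d⟩ (finLineTorus u_f) = finAdelicToAdelic u_f` — the
torus bookkeeping `adelicCenter ↔ finAdelicToAdelic (M := 1)`. -/
theorem cmCenter_finLineTorus
    (uf : ↥(UnitaryGroup.finAdelic (↥(maximalRealSubfield K)) K (IsCMField.complexConj K) 1 (Matrix.diagonal (lineVec K d)))) :
    CMCenter K (lineVec K d) (finLineTorus K d hd0 uf) =
      UnitaryGroup.finAdelicToAdelic (↥(maximalRealSubfield K)) K (IsCMField.complexConj K) 1 (Matrix.diagonal (lineVec K d)) uf :=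
  cmCenter_cmAdelicDet_line K d hd0 _

/-- `finLineTorus` is injective (the centre is a left inverse). -/
theorem finLineTorus_injective : Function.Injective (finLineTorus K d hd0) := fun u v h => by
  have h' := congrArg (CMCenter K (lineVec K d)) h
  rw [cmCenter_finLineTorus, cmCenter_finLineTorus] at h'
  exact UnitaryGroup.finAdelicToAdelic_injective _ K _ 1 _ h'

/-- **the finite torus in the idele currency `ker N_{K/K⁺}`** (the second slot of `lineRepOf`): `u_f ↦ ♯ det (1_∞, u_f)`. -/
def finLineTorusIdeles :
    ↥(UnitaryGroup.finAdelic (↥(maximalRealSubfield K)) K (IsCMField.complexConj K) 1 (Matrix.diagonal (lineVec K d))) →*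
      ↥(Literature.NumberTheory.Automorphic.relNormOneIdeles (↥(maximalRealSubfield K)) K) :=
  (cmAdelicOneEquivRelNormOne K).toMonoidHom.comp (finLineTorus K d hd0)

/-- (Ported verbatim from the HodgeCMPerL package; no docstring in the source.) -/
@[simp] theorem cmAdelicOneEquivRelNormOne_symm_finLineTorusIdeles
    (uf : ↥(UnitaryGroup.finAdelic (↥(maximalRealSubfield K)) K (IsCMField.complexConj K) 1 (Matrix.diagonal (lineVec K d)))) :
    (cmAdelicOneEquivRelNormOne K).symm (finLineTorusIdeles K d hd0 uf) = finLineTorus K d hd0 uf :=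
  (cmAdelicOneEquivRelNormOne K).symm_apply_apply _

/-- underlying idele: unchanged. -/
theorem coe_finLineTorusIdeles
    (uf : ↥(UnitaryGroup.finAdelic (↥(maximalRealSubfield K)) K (IsCMField.complexConj K) 1 (Matrix.diagonal (lineVec K d)))) :
    ((finLineTorusIdeles K d hd0 uf : ↥(Literature.NumberTheory.Automorphic.relNormOneIdeles (↥(maximalRealSubfield K)) K)) :
        (AdeleRing (𝓞 K) K)ˣ) = (finLineTorus K d hd0 uf : (AdeleRing (𝓞 K) K)ˣ) :=
  rfl


/-! #### § 4b. Every torus element factors: `t = (t_∞, 1) · ♯ det (1_∞, t_f)` -/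

omit [IsCMField K] in
/-- entries of the archimedean component `g_∞` of an adelic matrix: `e((g i j)_∞)`, `e = ringEquiv_mixedSpace` (definitional). -/
theorem coe_toMixed_apply {n : ℕ} (g : GL (Fin n) (AdeleRing (𝓞 K) K)) (i j : Fin n) :
    ((GLn.toMixed n K g : GL (Fin n) (mixedSpace K)) : Matrix (Fin n) (Fin n) (mixedSpace K)) i j =
      InfiniteAdeleRing.ringEquiv_mixedSpace K (((g : Matrix (Fin n) (Fin n) (AdeleRing (𝓞 K) K)) i j).1) :=
  rfl

/-- **the archimedean component of the centre is the centre of the archimedean component** (any rank `N`, any form `H`):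
`(t♭ · 1_N)_∞ = t_∞ · 1_N` in `U(H)(K ⊗ ℝ)` — entrywise `e((t · δ_ij)_∞) = e(t_∞) · δ_ij`, as in the tree's `archToAdelic_archCenter`. -/
theorem archPart_cmCenter_symm {N : ℕ} (H : Matrix (Fin N) (Fin N) K)
    (t : ↥(Literature.NumberTheory.Automorphic.relNormOneIdeles (↥(maximalRealSubfield K)) K)) :
    UnitaryGroup.archPart (↥(maximalRealSubfield K)) K (IsCMField.complexConj K) N H
        (UnitaryGroup.adelicCenter (↥(maximalRealSubfield K)) K (IsCMField.complexConj K) N H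
          ((cmAdelicOneEquivRelNormOne K).symm t)) =
      cmArchCenter K N H (Literature.NumberTheory.Automorphic.relNormOneInfPart K (↥(maximalRealSubfield K)) t) := by
  apply Subtype.ext
  rw [UnitaryGroup.coe_archPart]
  apply Units.ext
  rw [cmArchCenter_eq, UnitaryGroup.coe_archCenter]
  refine Matrix.ext fun i j => ?_
  rw [coe_toMixed_apply, UnitaryGroup.adelicVal_apply, UnitaryGroup.coe_adelicCenter, Matrix.smul_apply, Matrix.smul_apply,
    smul_eq_mul, smul_eq_mul]
  by_cases hij : i = j
  · subst hij
    rw [Matrix.one_apply_eq, Matrix.one_apply_eq, mul_one, mul_one]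
    rfl
  · rw [Matrix.one_apply_ne hij, Matrix.one_apply_ne hij, mul_zero, mul_zero]
    exact map_zero _

/-- **the finite component of a torus element, read in `U(⟨d⟩)(𝔸_{K⁺,f})`**: `t ↦ (t♭ · 1₁)_f`. -/
def finLineTorusInv :
    ↥(Literature.NumberTheory.Automorphic.relNormOneIdeles (↥(maximalRealSubfield K)) K) →*
      ↥(UnitaryGroup.finAdelic (↥(maximalRealSubfield K)) K (IsCMField.complexConj K) 1 (Matrix.diagonal (lineVec K d))) :=
  (UnitaryGroup.finPart (↥(maximalRealSubfield K)) K (IsCMField.complexConj K) 1 (Matrix.diagonal (lineVec K d))).comp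
    ((CMCenter K (lineVec K d)).comp (cmAdelicOneEquivRelNormOne K).symm.toMonoidHom)

/-- (Ported verbatim from the HodgeCMPerL package; no docstring in the source.) -/
theorem finLineTorusInv_apply (t : ↥(Literature.NumberTheory.Automorphic.relNormOneIdeles (↥(maximalRealSubfield K)) K)) :
    finLineTorusInv K d t =
      UnitaryGroup.finPart (↥(maximalRealSubfield K)) K (IsCMField.complexConj K) 1 (Matrix.diagonal (lineVec K d))
        (CMCenter K (lineVec K d) ((cmAdelicOneEquivRelNormOne K).symm t)) :=
  rfl

/-- `(♯ det (1_∞, u_f))_f = u_f`: `finLineTorusInv` is a left inverse of `finLineTorusIdeles`. -/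
theorem finLineTorusInv_finLineTorusIdeles
    (uf : ↥(UnitaryGroup.finAdelic (↥(maximalRealSubfield K)) K (IsCMField.complexConj K) 1 (Matrix.diagonal (lineVec K d)))) :
    finLineTorusInv K d (finLineTorusIdeles K d hd0 uf) = uf := by
  rw [finLineTorusInv_apply, cmAdelicOneEquivRelNormOne_symm_finLineTorusIdeles, cmCenter_finLineTorus,
    UnitaryGroup.finPart_finAdelicToAdelic]

/-- **`t♭ · 1₁ = (t_∞ · 1₁, 1) · (1, t_f)` in `U(⟨d⟩)(𝔸_{K⁺})`**: the centre of the line at ANY torus element is the archimedean centre of its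
archimedean part times the finite-adelic element `finLineTorusInv t`. -/
theorem cmCenter_symm_eq_archToAdelic_mul_finAdelicToAdelic
    (t : ↥(Literature.NumberTheory.Automorphic.relNormOneIdeles (↥(maximalRealSubfield K)) K)) :
    CMCenter K (lineVec K d) ((cmAdelicOneEquivRelNormOne K).symm t) =
      UnitaryGroup.archToAdelic (↥(maximalRealSubfield K)) K (IsCMField.complexConj K) 1 (Matrix.diagonal (lineVec K d))
          (cmArchCenter K 1 (Matrix.diagonal (lineVec K d)) (Literature.NumberTheory.Automorphic.relNormOneInfPart K (↥(maximalRealSubfield K)) t)) *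
        UnitaryGroup.finAdelicToAdelic (↥(maximalRealSubfield K)) K (IsCMField.complexConj K) 1 (Matrix.diagonal (lineVec K d))
          (finLineTorusInv K d t) := by
  rw [← archPart_cmCenter_symm, finLineTorusInv_apply, UnitaryGroup.archToAdelic_mul_finAdelicToAdelic]

include hd0 in
/-- the centre of a hermitian line is injective (`det (u · 1₁) = u`). -/
theorem cmCenter_line_injective : Function.Injective (CMCenter K (lineVec K d)) := fun a b h => by
  have h' := congrArg (cmAdelicDet K (lineVec K d) (fun _ => hd0)) h
  rwa [cmAdelicDet_center, cmAdelicDet_center, pow_one, pow_one] at h'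

/-- **EVERY torus element factors through § 2 and § 4**: `t = (t_∞, 1) · ♯ det (1_∞, t_f)` in `ker N_{K/K⁺}(𝔸)`, with `t_∞ = relNormOneInfPart t`
and `t_f = finLineTorusInv d t ∈ U(⟨d⟩)(𝔸_{K⁺,f})` — so `lineRepOf k (1, t) = lineRepOf k (1, (t_∞,1)) ∘ lineRepOf k (1, ♯ det (1_∞, t_f))` by `map_mul`, and the two
factors are `lineRepOf_k_one_inf_eq_adelicTensorEnd` and `lineRepOf_k_one_finLineTorus`. -/
theorem eq_relNormOneInfToIdeles_mul_finLineTorusIdeles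
    (t : ↥(Literature.NumberTheory.Automorphic.relNormOneIdeles (↥(maximalRealSubfield K)) K)) :
    t = Literature.NumberTheory.Automorphic.relNormOneInfToIdeles (↥(maximalRealSubfield K)) K
            (Literature.NumberTheory.Automorphic.relNormOneInfPart K (↥(maximalRealSubfield K)) t) *
          finLineTorusIdeles K d hd0 (finLineTorusInv K d t) := by
  apply (cmAdelicOneEquivRelNormOne K).symm.injective
  apply cmCenter_line_injective K d hd0
  rw [map_mul, map_mul, cmAdelicOneEquivRelNormOne_symm_finLineTorusIdeles, cmCenter_finLineTorus,
    ← archToAdelic_cmArchCenter K 1 (Matrix.diagonal (lineVec K d)) (Literature.NumberTheory.Automorphic.relNormOneInfPart K (↥(maximalRealSubfield K)) t)]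
  exact cmCenter_symm_eq_archToAdelic_mul_finAdelicToAdelic K d t

end FinTorus

section FinTorusLines

variable
  (hGR : (cmSplittingDatum (L : Type) finProdFinEquiv (frameD V) (frameD_real V) (frameD_ne V) (dW S) (dW_real S) (dW_ne S)).CompatibleSplitting)
  (hGR₀ : (cmSplittingDatum (L : Type) (e₁) (frameD V) (frameD_real V) (frameD_ne V) (lineVec (L : Type) (dW S 0))
    (fun _ => dW_real S 0) (fun _ => dW_ne S 0)).CompatibleSplitting)
  (hGR₁ : (cmSplittingDatum (L : Type) (e₁) (frameD V) (frameD_real V) (frameD_ne V) (lineVec (L : Type) (dW S 1))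
    (fun _ => dW_real S 1) (fun _ => dW_ne S 1)).CompatibleSplitting)
  (hGR₂ : (cmSplittingDatum (L : Type) (e₁) (frameD V) (frameD_real V) (frameD_ne V) (lineVec (L : Type) (dW' S 0))
    (fun _ => dW'_real S 0) (fun _ => dW'_ne S 0)).CompatibleSplitting)
  (hGR₃ : (cmSplittingDatum (L : Type) (e₁) (frameD V) (frameD_real V) (frameD_ne V) (lineVec (L : Type) (dW' S 1))
    (fun _ => dW'_real S 1) (fun _ => dW'_ne S 1)).CompatibleSplitting)
  (η₀ η₁ η₂ η₃ : CMAdelic (L : Type) (frameD V) × CMAdelicOne (L : Type) →* ℂˣ)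

/-- **(iii)_fin input, line 0**: at the finite torus element of `u_f ∈ U(⟨a₀⟩)(𝔸_f)` the honest line representation is the small pair's
Weil representation at the pair element `(1, (1_∞, u_f))`, up to the torus scalar:
`lineRepOf 0 (1, ♯(finLineTorus u_f)) φ = c₀(finLineTorus u_f) • cmPairRep e₁ hGR₀ (1, (1_∞, u_f)) φ`. -/
theorem lineRepOf_zero_one_finLineTorus
    (uf : ↥(UnitaryGroup.finAdelic (↥(maximalRealSubfield L)) L (IsCMField.complexConj L) 1 (Matrix.diagonal (lineVec (L : Type) (dW S 0)))))
    (φ : piSchwartzBruhat (↥(maximalRealSubfield L)) (Fin 3)) :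
    lineRepOf V S hGR hGR₀ hGR₁ hGR₂ hGR₃ η₀ η₁ η₂ η₃ 0 (1, finLineTorusIdeles (L : Type) (dW S 0) (dW_ne S 0) uf) φ =
      ((torusScalar_zeroG V S hGR hGR₀ hGR₁ η₀ (finLineTorus (L : Type) (dW S 0) (dW_ne S 0) uf) : ℂˣ) : ℂ) •
        cmPairRep (L : Type) e₁ (frameD V) (frameD_real V) (frameD_ne V) (lineVec (L : Type) (dW S 0)) (fun _ => dW_real S 0)
          (fun _ => dW_ne S 0) hGR₀
          (1, UnitaryGroup.finAdelicToAdelic (↥(maximalRealSubfield L)) L (IsCMField.complexConj L) 1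
            (Matrix.diagonal (lineVec (L : Type) (dW S 0))) uf) φ := by
  have h := cmLineRepFin₀_apply_eq_smul_cmPairRep (L : Type) finProdFinEquiv e₁ (frameD V) (frameD_real V) (frameD_ne V)
    (dW S) (dW_real S) (dW_ne S) hGR hGR₀ hGR₁ η₀ 1 (finLineTorusIdeles (L : Type) (dW S 0) (dW_ne S 0) uf) φ
  rw [cmAdelicOneEquivRelNormOne_symm_finLineTorusIdeles, cmCenter_finLineTorus] at h
  show lineRep V S hGR hGR₀ hGR₁ hGR₂ hGR₃ η₀ η₁ η₂ η₃ 0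
      ((cmFrameEquiv (L : Type) (frameG V) V.Hm (frameD V) (frame_congr V))
          ((1 : ↥(regimeSubgroup L V.Hm)) : ↥(HodgeCM.Adelic.adelicUnitaryGroup (L : Type) V.Hm)), _) φ = _
  rw [cmFrameEquiv_regime_one, torusScalar_zero_applyG, cmCenter_finLineTorus]
  exact h

/-- **(iii)_fin input, line 1**. -/
theorem lineRepOf_one_one_finLineTorus
    (uf : ↥(UnitaryGroup.finAdelic (↥(maximalRealSubfield L)) L (IsCMField.complexConj L) 1 (Matrix.diagonal (lineVec (L : Type) (dW S 1)))))
    (φ : piSchwartzBruhat (↥(maximalRealSubfield L)) (Fin 3)) :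
    lineRepOf V S hGR hGR₀ hGR₁ hGR₂ hGR₃ η₀ η₁ η₂ η₃ 1 (1, finLineTorusIdeles (L : Type) (dW S 1) (dW_ne S 1) uf) φ =
      ((torusScalar_oneG V S hGR hGR₀ hGR₁ η₁ (finLineTorus (L : Type) (dW S 1) (dW_ne S 1) uf) : ℂˣ) : ℂ) •
        cmPairRep (L : Type) e₁ (frameD V) (frameD_real V) (frameD_ne V) (lineVec (L : Type) (dW S 1)) (fun _ => dW_real S 1)
          (fun _ => dW_ne S 1) hGR₁
          (1, UnitaryGroup.finAdelicToAdelic (↥(maximalRealSubfield L)) L (IsCMField.complexConj L) 1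
            (Matrix.diagonal (lineVec (L : Type) (dW S 1))) uf) φ := by
  have h := cmLineRepFin₁_apply_eq_smul_cmPairRep (L : Type) finProdFinEquiv e₁ (frameD V) (frameD_real V) (frameD_ne V)
    (dW S) (dW_real S) (dW_ne S) hGR hGR₀ hGR₁ η₁ 1 (finLineTorusIdeles (L : Type) (dW S 1) (dW_ne S 1) uf) φ
  rw [cmAdelicOneEquivRelNormOne_symm_finLineTorusIdeles, cmCenter_finLineTorus] at h
  show lineRep V S hGR hGR₀ hGR₁ hGR₂ hGR₃ η₀ η₁ η₂ η₃ 1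
      ((cmFrameEquiv (L : Type) (frameG V) V.Hm (frameD V) (frame_congr V))
          ((1 : ↥(regimeSubgroup L V.Hm)) : ↥(HodgeCM.Adelic.adelicUnitaryGroup (L : Type) V.Hm)), _) φ = _
  rw [cmFrameEquiv_regime_one, torusScalar_one_applyG, cmCenter_finLineTorus]
  exact h

/-- **(iii)_fin input, line 2** (conjugated plane). -/
theorem lineRepOf_two_one_finLineTorus
    (uf : ↥(UnitaryGroup.finAdelic (↥(maximalRealSubfield L)) L (IsCMField.complexConj L) 1 (Matrix.diagonal (lineVec (L : Type) (dW' S 0)))))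
    (φ : piSchwartzBruhat (↥(maximalRealSubfield L)) (Fin 3)) :
    lineRepOf V S hGR hGR₀ hGR₁ hGR₂ hGR₃ η₀ η₁ η₂ η₃ 2 (1, finLineTorusIdeles (L : Type) (dW' S 0) (dW'_ne S 0) uf) φ =
      ((torusScalar_twoG V S hGR hGR₂ hGR₃ η₂ (finLineTorus (L : Type) (dW' S 0) (dW'_ne S 0) uf) : ℂˣ) : ℂ) •
        cmPairRep (L : Type) e₁ (frameD V) (frameD_real V) (frameD_ne V) (lineVec (L : Type) (dW' S 0)) (fun _ => dW'_real S 0)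
          (fun _ => dW'_ne S 0) hGR₂
          (1, UnitaryGroup.finAdelicToAdelic (↥(maximalRealSubfield L)) L (IsCMField.complexConj L) 1
            (Matrix.diagonal (lineVec (L : Type) (dW' S 0))) uf) φ := by
  have h := cmConjLineRepFin₀_apply_eq_smul_cmPairRep (L : Type) finProdFinEquiv e₁ (frameD V) (frameD_real V) (frameD_ne V)
    (dW S) (dW_real S) (dW_ne S) (dW' S) (dW'_real S) (dW'_ne S) S.isoGL (isoGL_hg₀ S) hGR hGR₂ hGR₃ η₂ 1
    (finLineTorusIdeles (L : Type) (dW' S 0) (dW'_ne S 0) uf) φ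
  rw [cmAdelicOneEquivRelNormOne_symm_finLineTorusIdeles, cmCenter_finLineTorus] at h
  show lineRep V S hGR hGR₀ hGR₁ hGR₂ hGR₃ η₀ η₁ η₂ η₃ 2
      ((cmFrameEquiv (L : Type) (frameG V) V.Hm (frameD V) (frame_congr V))
          ((1 : ↥(regimeSubgroup L V.Hm)) : ↥(HodgeCM.Adelic.adelicUnitaryGroup (L : Type) V.Hm)), _) φ = _
  rw [cmFrameEquiv_regime_one, torusScalar_two_applyG, cmCenter_finLineTorus]
  exact h

/-- **(iii)_fin input, line 3** (conjugated plane). -/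
theorem lineRepOf_three_one_finLineTorus
    (uf : ↥(UnitaryGroup.finAdelic (↥(maximalRealSubfield L)) L (IsCMField.complexConj L) 1 (Matrix.diagonal (lineVec (L : Type) (dW' S 1)))))
    (φ : piSchwartzBruhat (↥(maximalRealSubfield L)) (Fin 3)) :
    lineRepOf V S hGR hGR₀ hGR₁ hGR₂ hGR₃ η₀ η₁ η₂ η₃ 3 (1, finLineTorusIdeles (L : Type) (dW' S 1) (dW'_ne S 1) uf) φ =
      ((torusScalar_threeG V S hGR hGR₂ hGR₃ η₃ (finLineTorus (L : Type) (dW' S 1) (dW'_ne S 1) uf) : ℂˣ) : ℂ) •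
        cmPairRep (L : Type) e₁ (frameD V) (frameD_real V) (frameD_ne V) (lineVec (L : Type) (dW' S 1)) (fun _ => dW'_real S 1)
          (fun _ => dW'_ne S 1) hGR₃
          (1, UnitaryGroup.finAdelicToAdelic (↥(maximalRealSubfield L)) L (IsCMField.complexConj L) 1
            (Matrix.diagonal (lineVec (L : Type) (dW' S 1))) uf) φ := by
  have h := cmConjLineRepFin₁_apply_eq_smul_cmPairRep (L : Type) finProdFinEquiv e₁ (frameD V) (frameD_real V) (frameD_ne V)
    (dW S) (dW_real S) (dW_ne S) (dW' S) (dW'_real S) (dW'_ne S) S.isoGL (isoGL_hg₀ S) hGR hGR₂ hGR₃ η₃ 1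
    (finLineTorusIdeles (L : Type) (dW' S 1) (dW'_ne S 1) uf) φ
  rw [cmAdelicOneEquivRelNormOne_symm_finLineTorusIdeles, cmCenter_finLineTorus] at h
  show lineRep V S hGR hGR₀ hGR₁ hGR₂ hGR₃ η₀ η₁ η₂ η₃ 3
      ((cmFrameEquiv (L : Type) (frameG V) V.Hm (frameD V) (frame_congr V))
          ((1 : ↥(regimeSubgroup L V.Hm)) : ↥(HodgeCM.Adelic.adelicUnitaryGroup (L : Type) V.Hm)), _) φ = _
  rw [cmFrameEquiv_regime_one, torusScalar_three_applyG, cmCenter_finLineTorus]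
  exact h

end FinTorusLines

end HodgeCM.Model.ArchSideTerm

end
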